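import Summits.QuantumFields.YangMills.Theorems.BalabanUVNodesK0Stub1ExtensionTransposes
import Summits.QuantumFields.YangMills.Theorems.BalabanUVNodesK0Stub1V0CurrentFrechet
import Summits.QuantumFields.YangMills.Theorems.UnitScaleTiltProp8FlatCubeQContraction
import HarnessLib

/-!
# K0⁷ STUB 1 (`stub_prop8StepCoP13`), sub-target S4b «the (δ∕δA′)V pieces at objects», brick 12 (the capstone's structural hypotheses AT THE RECORD's OPERATORS):
# **THE PAIRING (27) ON `PBond P 0 → 𝔸`, AN UNWEIGHTED TRACE PAIRING ON BLOCK DATA, AND THE TRANSPOSES `Q*_V`, `H*_V` AND THE MULTIPLIER `M_V = ((QGQ*)⁻¹ − a)_V`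
# OF THE COMPONENTWISE EXTENSIONS OF PRINT's FLAT OPERATORS** — the hypotheses `hBE`, `hB`, `hQt`, `hHt`, `hM` of `K0Stub1SectFWSlotOneLevel.exists_sectF_W_oneLevel ∕
# _levOf` DISCHARGED for every nested family `D : Domains P`, so that only the chart data (`D`, `𝔇`, `𝔇ᵗ`: S2) and the seven printed letters remain displayed

Cell `pub-ymgap`, width seat `pub-ymgap-k0-s1-w2` g2 (director-ym №197 ∕ HUMAN RULING D-0149; plan g77–g81 W-SEAT-START-LIST §k0-s1, w2 ↦ S4b).
`--kind proof --supports stmt-QuantumFields-20541 --as helper`; count-neutral.  [15] = [Balaban1985Variational]; [B6] = [Balaban1984PropagatorsII].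

WHY.  The capstone (brick 10) takes the pairings `BE` (27), `B`, and the operators `Q`, `H`, `M` with transposes `Qt`, `Ht` as PARAMETERS displayed by identities.  At the
record these are: `BE` = pv27's `bondPair η d τ` read on `PBond P 0` (brick 9 `exists_bondPairCLM`); `Q_V`, `H_V` = the componentwise extensions of lit-balaban's `QE D`,
`hOp (GE D) (QsE D) (EE D)` (k0-s1-w1 g2 `…K0Stub1Eq158FlatOpsMatrixFields.exists_extensions_flatOps`, kernel form `Σ_j g(e_j)(b)•A j`); `M_V` = the extension of
`EE D − aE D w` (print's `(QGQ*)⁻¹ − a`, Euclidean-symmetric: UST `FlatCubeOperators.inner_EE_left`, lit-balaban `inner_aE_left`); `Q*_V`, `H*_V` = the extensions of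
the transposed kernels scaled by the volume factor of (27) (brick 11).  THIS FILE packages them with the five identities PROVED.

WHAT IS PROVED (sorry-free; no definition; axioms standard).  Every `P : Params`, `D : Domains P`, `c ≠ 0`, `w > 0`, `η ≠ 0`, `d`, fibre `𝔸` (finite-dimensional
`ℂ`-algebra) with a TRACIAL linear functional `τ`.
* §1 `bondPair_PBond_eq_sum` — (27) read on `PBond P 0` is `η^d·Σ_{b : PBond} τ(Y b·δ b)` (reindexing `(x, μ) ↔ ⟨x, μ⟩`); `exists_blockPairCLM` — the unweighted block pairing
  `B X X′ = Σ_t τ(X t·X′ t)` as a continuous bilinear map, symmetric for tracial `τ` (`blockPair_symm`).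
* §2 ★★ `exists_pairings_transposes_flatOps` — `∃ BE B Q_V H_V M_V Qt_V Ht_V` (continuous linear ∕ bilinear maps on `PBond P 0 → 𝔸` and `BondIdx D → 𝔸`) with: `BE` = (27)
  (brick 9's shape `hBE`), `B` the block pairing, the KERNEL FORMULAS of `Q_V`, `H_V` (k0-s1-w1's, verbatim shape), of `M_V` (extension of `EE D − aE D w`) and of
  `Qt_V`, `Ht_V` (transposed kernels scaled by `η^{−d}`), AND the capstone's five structural hypotheses: `hB` (symmetry), `hM` (`B (M_V a) b = B a (M_V b)`),
  `hQt` (`BE (Qt_V X) δ = B X (Q_V δ)`), `hHt` (`BE Z (H_V X) = B (Ht_V Z) X`).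
* §3 ★ `norm_QV_apply_le`, `letterQ_QV_oneLevel` — ONE of the seven letters DISCHARGED at one level: «the average does not increase the size», `q = 1` for `Q_V`
  (UST `FlatCubeQContraction.abs_Qfun_le` + `FlatScalarExtension.sup_extension_le`).
HONEST SCOPE.  Packaging + finite-sum algebra over bricks 9 ∕ 11 and k0-s1-w1's ∕ UST's ∕ lit-balaban's objects BY NAME; the block pairing is UNWEIGHTED (print's (66)
volume factors `(L^jη)^d` are absorbed into the capstone's block weights `wB, wB′` — the letters' business); `D`, `𝔇`, `𝔇ᵗ` (S2's chart) and the seven letters stay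
displayed; nothing of [15]'s analysis asserted; `stub_prop8StepCoP13` ∕ K0⁷ NOT closed; N07 NOT discharged; counts unmoved (28∕28 · 5∕27); one finite 𝕋⁴ programme at
fixed ε — R4 closes the conditional finite-𝕋⁴ rung `BalabanLadder.UV` only, never the summit; the YM mass gap (Clay) is NOT proved by any of this; nothing continuum ∕
ℝ⁴ ∕ OS.  No `sorry`, no `def`, no `instance`, no `notation`.

References: [15] (27) p.282, (45) p.285, (66) p.287, (87)–(88) p.291, p.288, (157) p.302; [B6] (2.19) p.226, (2.35) p.228.
-/

set_option autoImplicit false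

noncomputable section

namespace Summit.QuantumFields.YangMills.Theorems.K0Stub1PairingsAtExtensions

open scoped BigOperators InnerProductSpace
open Literature.MathematicalPhysics.QuantumFieldTheory.Balaban1983to89
open Literature.MathematicalPhysics.QuantumFieldTheory.BalabanImbrieJaffe1984to88.BIJ85AxialPropagator411 (BondSpace)
open B9Eq39Adjoint (bondPair)
open B6SectADomainsV1 (Domains)
open B6SectAOperatorsV1 (BondIdx BondIdxSpace QE QsE aE inner_aE_left inner_eq_sum)
open B6SectAVectorModelV1 (GE EE)
open B6SectA (hOp)
open Summit.QuantumFields.YangMills.Theorems.FlatCubeOperators (inner_EE_left)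
open Summit.QuantumFields.YangMills.Theorems.FlatScalarExtension (exists_extension)
open Summit.QuantumFields.YangMills.Theorems.K0Stub1ExtensionTransposes (exists_transposeExtension sum_pair_transposeExtension sum_pair_extension_symm
  kernel_symm_of_inner_symm)
open Summit.QuantumFields.YangMills.Theorems.K0Stub1V0CurrentFrechet (exists_bondPairCLM)

/-! ## §1  The two pairings -/

section Pairings

variable {P : Params} {𝔸 : Type*} [NormedRing 𝔸] [NormedAlgebra ℂ 𝔸]

/-- **(27) READ ON `PBond P 0` IS `η^d·Σ_b τ(Y b·δ b)`** — pv27's `bondPair η d τ` of the readings `μ x ↦ Y⟨x, μ⟩` is the bond sum (the finite type `PBond P 0` is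
`Site P 0 × Fin d` reindexed). [cite: Balaban1985Variational, (27) p.282] -/
theorem bondPair_PBond_eq_sum (η : ℝ) (τ : 𝔸 →ₗ[ℂ] ℂ) (Y δ : PBond P 0 → 𝔸) :
    bondPair η P.d τ (fun μ x => Y ⟨x, μ⟩) (fun μ x => δ ⟨x, μ⟩) = (η : ℂ) ^ P.d * ∑ b : PBond P 0, τ (Y b * δ b) := by
  unfold bondPair
  congr 1
  rw [← Fintype.sum_prod_type' (fun x μ => τ (Y ⟨x, μ⟩ * δ ⟨x, μ⟩))]
  exact Fintype.sum_equiv (LatticeFieldCalculus.bondEquiv (P := P) (j := 0)) _ _ fun _ => rfl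

variable [FiniteDimensional ℂ 𝔸]

/-- **THE UNWEIGHTED TRACE PAIRING ON BLOCK DATA AS A CONTINUOUS BILINEAR MAP**: `∃ B, B X X′ = Σ_t τ(X t·X′ t)` on `ι → 𝔸`, any finite `ι` (print's (66) without the
volume factors, which the capstone's block weights carry). [cite: Balaban1985Variational, (66) p.287] -/
theorem exists_blockPairCLM {ι : Type*} [Fintype ι] (τ : 𝔸 →ₗ[ℂ] ℂ) :
    ∃ B : (ι → 𝔸) →L[ℂ] (ι → 𝔸) →L[ℂ] ℂ, ∀ X X' : ι → 𝔸, B X X' = ∑ t, τ (X t * X' t) := by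
  classical
  let Bₗ : (ι → 𝔸) →ₗ[ℂ] (ι → 𝔸) →ₗ[ℂ] ℂ :=
    LinearMap.mk₂ ℂ (fun X X' => ∑ t, τ (X t * X' t))
      (fun X Y X' => by simp only [Pi.add_apply, add_mul, map_add, Finset.sum_add_distrib])
      (fun z X X' => by simp only [Pi.smul_apply, smul_mul_assoc, map_smul, smul_eq_mul, Finset.mul_sum])
      (fun X X' Y' => by simp only [Pi.add_apply, mul_add, map_add, Finset.sum_add_distrib])
      (fun z X X' => by simp only [Pi.smul_apply, mul_smul_comm, map_smul, smul_eq_mul, Finset.mul_sum])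
  let B₁ : (ι → 𝔸) →ₗ[ℂ] ((ι → 𝔸) →L[ℂ] ℂ) :=
    (LinearMap.toContinuousLinearMap : ((ι → 𝔸) →ₗ[ℂ] ℂ) ≃ₗ[ℂ] ((ι → 𝔸) →L[ℂ] ℂ)).toLinearMap ∘ₗ Bₗ
  exact ⟨LinearMap.toContinuousLinearMap B₁, fun X X' => rfl⟩

omit [FiniteDimensional ℂ 𝔸] in
/-- The block trace pairing is symmetric for a tracial `τ`. [folklore] -/
theorem blockPair_symm {ι : Type*} [Fintype ι] (τ : 𝔸 →ₗ[ℂ] ℂ) (hτ : ∀ a b : 𝔸, τ (a * b) = τ (b * a)) (X X' : ι → 𝔸) :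
    ∑ t, τ (X t * X' t) = ∑ t, τ (X' t * X t) :=
  Finset.sum_congr rfl fun _ _ => hτ _ _

end Pairings

/-! ## §2  ★★ The pairings, the extensions and their transposes for a nested family, with the capstone's five structural hypotheses proved -/

section AtRecord

variable {P : Params} (D : Domains P) {c : ℝ} (hc : c ≠ 0) {w : BondIdx D → ℝ} (hw : ∀ i, 0 < w i)
variable {𝔸 : Type*} [NormedRing 𝔸] [NormedAlgebra ℂ 𝔸] [FiniteDimensional ℂ 𝔸]

open scoped Classical in
/-- ★★ **THE CAPSTONE's STRUCTURAL DATA AT THE RECORD's FLAT OPERATORS.**  For every nested family `D` (`c ≠ 0`, weights `w > 0`), `η ≠ 0`, and a finite-dimensional fibre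
`𝔸` with a TRACIAL functional `τ`: there are the pairing `BE` = (27) on `PBond P 0 → 𝔸`, the unweighted block pairing `B` on `BondIdx D → 𝔸`, the componentwise
extensions `Q_V` of `QE D` and `H_V` of print's `H = hOp (GE D) (QsE D) (EE D)` (kernel form, k0-s1-w1's shape), the multiplier `M_V` = extension of `EE D − aE D w`
(`(QGQ*)⁻¹ − a`, (87)∕(137)), and the transposes `Qt_V`, `Ht_V` (transposed kernels times `η^{−d}`), SUCH THAT `B` is symmetric, `M_V` is `B`-symmetric, `BE (Qt_V X) δ =
B X (Q_V δ)` and `BE Z (H_V X) = B (Ht_V Z) X` — the hypotheses `hBE, hB, hM, hQt, hHt` of `K0Stub1SectFWSlotOneLevel.exists_sectF_W_oneLevel ∕ _levOf`, discharged.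
[cite: Balaban1985Variational, (27) p.282, (45) p.285, (66) p.287, (87)–(88) p.291, p.288; Balaban1984PropagatorsII, (2.35) p.228] -/
theorem exists_pairings_transposes_flatOps {η : ℝ} (hη : η ≠ 0) (τ : 𝔸 →ₗ[ℂ] ℂ) (hτ : ∀ a b : 𝔸, τ (a * b) = τ (b * a)) :
    ∃ (BE : (PBond P 0 → 𝔸) →L[ℂ] (PBond P 0 → 𝔸) →L[ℂ] ℂ) (B : (BondIdx D → 𝔸) →L[ℂ] (BondIdx D → 𝔸) →L[ℂ] ℂ)
      (QV : (PBond P 0 → 𝔸) →L[ℂ] (BondIdx D → 𝔸)) (HV : (BondIdx D → 𝔸) →L[ℂ] (PBond P 0 → 𝔸))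
      (MV : (BondIdx D → 𝔸) →L[ℂ] (BondIdx D → 𝔸))
      (QtV : (BondIdx D → 𝔸) →L[ℂ] (PBond P 0 → 𝔸)) (HtV : (PBond P 0 → 𝔸) →L[ℂ] (BondIdx D → 𝔸)),
      (∀ Y δ : PBond P 0 → 𝔸, BE Y δ = bondPair η P.d τ (fun μ x => Y ⟨x, μ⟩) (fun μ x => δ ⟨x, μ⟩)) ∧
      (∀ X X' : BondIdx D → 𝔸, B X X' = ∑ t, τ (X t * X' t)) ∧
      (∀ (A : PBond P 0 → 𝔸) (t : BondIdx D), QV A t = ∑ j, ((WithLp.ofLp (QE D (WithLp.toLp 2 (Pi.single j 1))) t : ℝ) : ℂ) • A j) ∧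
      (∀ (X : BondIdx D → 𝔸) (b : PBond P 0),
        HV X b = ∑ t, ((WithLp.ofLp (hOp (GE D hc hw) (QsE D) (EE D hc hw) (WithLp.toLp 2 (Pi.single t 1))) b : ℝ) : ℂ) • X t) ∧
      (∀ (X : BondIdx D → 𝔸) (t : BondIdx D),
        MV X t = ∑ s, ((WithLp.ofLp ((EE D hc hw - aE D w) (WithLp.toLp 2 (Pi.single s 1))) t : ℝ) : ℂ) • X s) ∧
      (∀ (X : BondIdx D → 𝔸) (j : PBond P 0),
        QtV X j = ((η : ℂ) ^ P.d)⁻¹ • ∑ t, ((WithLp.ofLp (QE D (WithLp.toLp 2 (Pi.single j 1))) t : ℝ) : ℂ) • X t) ∧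
      (∀ (Z : PBond P 0 → 𝔸) (t : BondIdx D),
        HtV Z t = ((η : ℂ) ^ P.d) • ∑ b, ((WithLp.ofLp (hOp (GE D hc hw) (QsE D) (EE D hc hw) (WithLp.toLp 2 (Pi.single t 1))) b : ℝ) : ℂ) • Z b) ∧
      (∀ a b, B a b = B b a) ∧
      (∀ a b, B (MV a) b = B a (MV b)) ∧
      (∀ X δ, BE (QtV X) δ = B X (QV δ)) ∧
      (∀ Z X, BE Z (HV X) = B (HtV Z) X) := by
  -- the real kernels, read through `WithLp`
  let q : (PBond P 0 → ℝ) →ₗ[ℝ] (BondIdx D → ℝ) :=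
    (WithLp.linearEquiv 2 ℝ (BondIdx D → ℝ)).toLinearMap ∘ₗ QE D ∘ₗ (WithLp.linearEquiv 2 ℝ (PBond P 0 → ℝ)).symm.toLinearMap
  let h : (BondIdx D → ℝ) →ₗ[ℝ] (PBond P 0 → ℝ) :=
    (WithLp.linearEquiv 2 ℝ (PBond P 0 → ℝ)).toLinearMap ∘ₗ hOp (GE D hc hw) (QsE D) (EE D hc hw) ∘ₗ
      (WithLp.linearEquiv 2 ℝ (BondIdx D → ℝ)).symm.toLinearMap
  let m : (BondIdx D → ℝ) →ₗ[ℝ] (BondIdx D → ℝ) :=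
    (WithLp.linearEquiv 2 ℝ (BondIdx D → ℝ)).toLinearMap ∘ₗ (EE D hc hw - aE D w) ∘ₗ (WithLp.linearEquiv 2 ℝ (BondIdx D → ℝ)).symm.toLinearMap
  have hq : ∀ (x : PBond P 0 → ℝ) (t : BondIdx D), q x t = WithLp.ofLp (QE D (WithLp.toLp 2 x)) t := fun _ _ => rfl
  have hh : ∀ (y : BondIdx D → ℝ) (b : PBond P 0), h y b = WithLp.ofLp (hOp (GE D hc hw) (QsE D) (EE D hc hw) (WithLp.toLp 2 y)) b := fun _ _ => rfl
  have hm : ∀ (y : BondIdx D → ℝ) (t : BondIdx D), m y t = WithLp.ofLp ((EE D hc hw - aE D w) (WithLp.toLp 2 y)) t := fun _ _ => rfl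
  obtain ⟨BE, hBE⟩ := exists_bondPairCLM (P := P) (𝔸 := 𝔸) 0 η P.d τ
  obtain ⟨B, hB⟩ := exists_blockPairCLM (ι := BondIdx D) (𝔸 := 𝔸) τ
  obtain ⟨QV, hQV⟩ := exists_extension q 𝔸
  obtain ⟨HV, hHV⟩ := exists_extension h 𝔸
  obtain ⟨MV, hMV⟩ := exists_extension m 𝔸
  obtain ⟨Qt, hQt⟩ := exists_transposeExtension q 𝔸
  obtain ⟨Ht, hHt⟩ := exists_transposeExtension h 𝔸
  have hηd : ((η : ℂ) ^ P.d) ≠ 0 := pow_ne_zero _ (Complex.ofReal_ne_zero.mpr hη)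
  -- the multiplier's kernel is symmetric (Euclidean symmetry of `EE` and `aE`)
  have hmsymm : ∀ i i' : BondIdx D, m (Pi.single i 1) i' = m (Pi.single i' 1) i := by
    refine kernel_symm_of_inner_symm m (fun x y => ?_)
    have h1 : ⟪(EE D hc hw - aE D w) (WithLp.toLp 2 x), WithLp.toLp 2 y⟫_ℝ = ⟪WithLp.toLp 2 x, (EE D hc hw - aE D w) (WithLp.toLp 2 y)⟫_ℝ := by
      rw [LinearMap.sub_apply, LinearMap.sub_apply, inner_sub_left, inner_sub_right, inner_EE_left, inner_aE_left]
    rw [inner_eq_sum, inner_eq_sum] at h1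
    simpa only [hm] using h1
  refine ⟨BE, B, LinearMap.toContinuousLinearMap QV, LinearMap.toContinuousLinearMap HV, LinearMap.toContinuousLinearMap MV,
    ((η : ℂ) ^ P.d)⁻¹ • LinearMap.toContinuousLinearMap Qt, ((η : ℂ) ^ P.d) • LinearMap.toContinuousLinearMap Ht,
    hBE, hB, ?_, ?_, ?_, ?_, ?_, ?_, ?_, ?_, ?_⟩
  · intro A t; rw [LinearMap.coe_toContinuousLinearMap', hQV]; rfl
  · intro X b; rw [LinearMap.coe_toContinuousLinearMap', hHV]; rfl
  · intro X t; rw [LinearMap.coe_toContinuousLinearMap', hMV]; rfl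
  · intro X j
    show ((η : ℂ) ^ P.d)⁻¹ • Qt X j = _
    rw [hQt]; rfl
  · intro Z t
    show ((η : ℂ) ^ P.d) • Ht Z t = _
    rw [hHt]; rfl
  · intro a b; rw [hB, hB]; exact blockPair_symm τ hτ a b
  · intro a b
    rw [hB, hB, LinearMap.coe_toContinuousLinearMap']
    exact sum_pair_extension_symm τ m hMV hmsymm a b
  · intro X δ
    rw [hBE, hB, bondPair_PBond_eq_sum]
    show (η : ℂ) ^ P.d * ∑ b, τ ((((η : ℂ) ^ P.d)⁻¹ • Qt X b) * δ b) = ∑ t, τ (X t * QV δ t)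
    simp only [smul_mul_assoc, map_smul, smul_eq_mul]
    rw [← Finset.mul_sum, sum_pair_transposeExtension τ q hQV hQt X δ, ← mul_assoc, mul_inv_cancel₀ hηd, one_mul]
  · intro Z X
    rw [hBE, hB, bondPair_PBond_eq_sum]
    show (η : ℂ) ^ P.d * ∑ b, τ (Z b * HV X b) = ∑ t, τ ((((η : ℂ) ^ P.d) • Ht Z t) * X t)
    simp only [smul_mul_assoc, map_smul, smul_eq_mul]
    rw [← Finset.mul_sum, sum_pair_transposeExtension τ h hHV hHt Z X]

end AtRecord

/-! ## §3  One of the seven letters, discharged at one level: «the average does not increase the size» (`q = 1`) for `Q_V` -/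

section Averaging

variable {P : Params} (D : Domains P)
variable {𝔸 : Type*} [NormedRing 𝔸] [NormedAlgebra ℂ 𝔸]

open scoped Classical in
/-- ★ **THE AVERAGING LETTER `q = 1` FOR THE EXTENSION `Q_V` OF THE MULTI-LEVEL AVERAGE** (one level, unit weights): `‖A b‖ ≤ r` for all fine bonds ⇒
`‖(Q_V A)(t)‖ ≤ r` at every index bond — UST's sup-contraction of the iterated average (`FlatCubeQContraction.abs_Qfun_le`: each `(Q_j u)(c)` is a convex
combination of the values of `u` over the two blocks of `c`) transferred to `𝔤ᶜ`-valued fields by UST `FlatScalarExtension.sup_extension_le`.  This is the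
hypothesis `hQ` of `K0Stub1SectFWSlotOneLevel.exists_sectF_W_oneLevel` with `wB = 1`, `q = 1`, PROVED for the operator of record.
[cite: Balaban1985Variational, (77) p.290, (88) p.291; Balaban1984PropagatorsII, (2.6) p.224, (2.20) p.226] -/
theorem norm_QV_apply_le (QV : (PBond P 0 → 𝔸) →L[ℂ] (BondIdx D → 𝔸))
    (hQV : ∀ (A : PBond P 0 → 𝔸) (t : BondIdx D), QV A t = ∑ j, ((WithLp.ofLp (QE D (WithLp.toLp 2 (Pi.single j 1))) t : ℝ) : ℂ) • A j)
    (A : PBond P 0 → 𝔸) {r : ℝ} (hr : 0 ≤ r) (hA : ∀ b, ‖A b‖ ≤ r) (t : BondIdx D) : ‖QV A t‖ ≤ r := by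
  have h := FlatScalarExtension.sup_extension_le (V := 𝔸) (FlatOpsLettersAssembly.Qfun D)
    (Gv := (QV : (PBond P 0 → 𝔸) →ₗ[ℂ] (BondIdx D → 𝔸))) (fun A' t' => by rw [ContinuousLinearMap.coe_coe]; exact hQV A' t') (C := 1)
    (fun x β hx c => by rw [one_mul]; exact FlatCubeQContraction.abs_Qfun_le D x c (fun b _ _ => hx b)) A hr hA t
  simpa using h

open scoped Classical in
/-- The same in the capstone's letter shape (`hQ` with `wB = 1`, `q = 1`): `(∀ b, ‖A b‖ ≤ r) ⇒ ∀ t, 1·‖Q_V A t‖ ≤ 1·r` (the bond type is inhabited, so `0 ≤ r`).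
[cite: Balaban1985Variational, (88) p.291] -/
theorem letterQ_QV_oneLevel (QV : (PBond P 0 → 𝔸) →L[ℂ] (BondIdx D → 𝔸))
    (hQV : ∀ (A : PBond P 0 → 𝔸) (t : BondIdx D), QV A t = ∑ j, ((WithLp.ofLp (QE D (WithLp.toLp 2 (Pi.single j 1))) t : ℝ) : ℂ) • A j)
    (A : PBond P 0 → 𝔸) (r : ℝ) (hA : ∀ b, ‖A b‖ ≤ r) (t : BondIdx D) : (1 : ℝ) * ‖QV A t‖ ≤ 1 * r := by
  have hr : 0 ≤ r := (norm_nonneg _).trans (hA ⟨default, ⟨0, P.hd⟩⟩)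
  rw [one_mul, one_mul]
  exact norm_QV_apply_le D QV hQV A hr hA t

end Averaging

end Summit.QuantumFields.YangMills.Theorems.K0Stub1PairingsAtExtensions

end
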